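import Summits.QuantumAdvantage.QuantumAdvantage.Theorems.WbwObfuscatedGluedTreesKowLevelVocabulary

/-!
# `WbwObfuscatedGluedTrees` (stmt-QuantumAdvantage-2340) — line `knowledge-of-walk-split`, instantiation pass: transport of clause (C) along seed permutations

Two registered helper stubs of the instantiation pass of the line `knowledge-of-walk-split` (crux
`WbwObfuscatedGluedTrees`, route `WhiteBoxWalk`; lead prover-line-stmt-QuantumAdvantage-2340-c1-0), in ONE file:

* `clauseC_seedPermutation`: if `π` permutes `{0,1}ⁿ` for every `n`, then clause (C) (`ClauseC` of
  `Negative/LoadBearing`) for `(gen, ans)` implies clause (C) for `(gen ∘ π, ans ∘ π)`.  Reason: the level-`n`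
  success probability of an adversary is a uniform AVERAGE over the seeds `s ∈ {0,1}ⁿ`, and re-indexing a
  finite average along a permutation does not change it (`uniformAvg_comp_of_bijOn`), so the two success
  sequences are literally equal.
* `bijOn_blockSwap`: the seed re-parametrisation `blockSwap a b c` of `WbwObfuscatedGluedTreesKowLevelVocabulary`
  (cut `s` as `A ++ X ++ Y ++ Z`, `|A| = a n`, `|X| = b n`, `|Y| = c n`, blocks truncated at the end of `s`,
  return `A ++ Y ++ X ++ Z`) is a permutation of `{0,1}ⁿ` for every `n`: it preserves the length, it is
  injective on `{0,1}ⁿ` (the four blocks have lengths depending on `n` only, so they can be read back with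
  `List.append_inj`), and an injective self-map of a finite set is a bijection.

Also (consumed by the sibling stub `gen_identification` and by the lead's composition): on seeds with
`a n + b n + c n ≤ n` the block read-outs `take_blockSwap`, `drop_take_blockSwap_mid`,
`drop_take_blockSwap_last`, `take_blockSwap_add`, `drop_blockSwap_add` and the inverse law
`blockSwap_blockSwap : blockSwap a c b (blockSwap a b c s) = s`.  Elementary list / finite-sum bookkeeping; no
hardness is asserted and no named fact is used.
-/

set_option linter.dupNamespace false

namespace Summit.QuantumAdvantage.QuantumAdvantage.Theorems.WbwObfuscatedGluedTrees.KnowledgeOfWalk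

open Literature.Computability.Cryptography Literature.Computability.Complexity Filter Asymptotics
open Summit.QuantumAdvantage.QuantumAdvantage.Theorems.WbwObfuscatedGluedTrees.Negative (ClauseC)

/-! ## Re-indexing the uniform average along a permutation of `{0,1}ⁿ` -/

/-- If `π` maps `{0,1}ⁿ` bijectively onto itself, the uniform average of `g ∘ π` over `{0,1}ⁿ` is the uniform
average of `g` (re-index the finite sum over `List.Vector Bool n` along the induced bijection). [folklore] -/
theorem uniformAvg_comp_of_bijOn {n : ℕ} {π : List Bool → List Bool}
    (hπ : Set.BijOn π {s : List Bool | s.length = n} {s : List Bool | s.length = n}) (g : List Bool → ℝ) :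
    uniformAvg n (g ∘ π) = uniformAvg n g := by
  unfold uniformAvg
  congr 1
  let e : List.Vector Bool n → List.Vector Bool n := fun v => ⟨π v.toList, hπ.mapsTo v.toList_length⟩
  have he : Function.Bijective e := by
    refine ⟨fun v w hvw => List.Vector.toList_injective
      (hπ.injOn v.toList_length w.toList_length (congrArg List.Vector.toList hvw)), fun w => ?_⟩
    obtain ⟨x, hx, hxw⟩ := hπ.surjOn w.toList_length
    exact ⟨⟨x, hx⟩, List.Vector.toList_injective hxw⟩
  exact he.sum_comp fun v : List.Vector Bool n => g v.toList

/-- **STUB `clauseC_seedPermutation`** of line `knowledge-of-walk-split` (instantiation pass; registered name and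
signature): clause (C) is transported along any seed re-parametrisation `π` permuting `{0,1}ⁿ` for every `n` —
the level-`n` success probability of every adversary against `(gen ∘ π, ans ∘ π)` EQUALS its success
probability against `(gen, ans)` (a re-indexed uniform average), so superpolynomial decay is inherited.
[folklore] -/
theorem clauseC_seedPermutation : ∀ (gen ans : List Bool → List Bool) (π : List Bool → List Bool),
    (∀ n : ℕ, Set.BijOn π {s : List Bool | s.length = n} {s : List Bool | s.length = n}) →
    ClauseC gen ans → ClauseC (gen ∘ π) (ans ∘ π) := by
  intro gen ans π hπ hC A hA
  refine (hC A hA).congr fun n => ?_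
  exact (uniformAvg_comp_of_bijOn (hπ n) fun s =>
    A.pr id (boolPair (Computability.unaryEncodeNat n) (gen s)) {y | ans s <+: y}).symm

/-! ## `blockSwap` is a permutation of `{0,1}ⁿ` -/

/-- Four-block decomposition of a list: `s = A ++ X ++ Y ++ Z` with `A = s ↾ p`, `X = (s ⇂ p) ↾ q`,
`Y = (s ⇂ (p+q)) ↾ r`, `Z = s ⇂ (p+q+r)` (blocks truncated at the end of `s`). [folklore] -/
theorem take_append_drop₄ (s : List Bool) (p q r : ℕ) :
    s.take p ++ ((s.drop p).take q ++ ((s.drop (p + q)).take r ++ s.drop (p + q + r))) = s := by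
  have h1 : (s.drop (p + q)).take r ++ s.drop (p + q + r) = s.drop (p + q) := by
    rw [← List.drop_drop (i := r) (j := p + q), List.take_append_drop]
  have h2 : (s.drop p).take q ++ s.drop (p + q) = s.drop p := by
    rw [← List.drop_drop (i := q) (j := p), List.take_append_drop]
  rw [h1, h2, List.take_append_drop]

/-- `blockSwap a b c` is injective on `{0,1}ⁿ`: the four blocks `A`, `Y`, `X`, `Z` of `blockSwap a b c s`
have lengths depending only on `n = |s|`, so they — and hence `s = A ++ X ++ Y ++ Z` — are determined by the
image. [folklore] -/
theorem injOn_blockSwap (a b c : ℕ → ℕ) (n : ℕ) :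
    Set.InjOn (blockSwap a b c) {s : List Bool | s.length = n} := by
  intro s hs t ht hst
  have hs' : s.length = n := hs
  have ht' : t.length = n := ht
  unfold blockSwap at hst
  rw [hs', ht'] at hst
  obtain ⟨hP, hrest⟩ := List.append_inj hst (by simp [hs', ht'])
  obtain ⟨hY, hrest'⟩ := List.append_inj hrest (by simp [hs', ht'])
  obtain ⟨hX, hZ⟩ := List.append_inj hrest' (by simp [hs', ht'])
  rw [← take_append_drop₄ s (a n) (b n) (c n), ← take_append_drop₄ t (a n) (b n) (c n), hP, hX, hY, hZ]

/-- **STUB `bijOn_blockSwap`** of line `knowledge-of-walk-split` (instantiation pass; registered name and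
signature): for every `n`, `blockSwap a b c` is a permutation of `{0,1}ⁿ` (length-preserving and injective on
the finite set `{0,1}ⁿ`, hence bijective onto it). [folklore] -/
theorem bijOn_blockSwap : ∀ (a b c : ℕ → ℕ) (n : ℕ),
    Set.BijOn (blockSwap a b c) {s : List Bool | s.length = n} {s : List Bool | s.length = n} := by
  intro a b c n
  have hm : Set.MapsTo (blockSwap a b c) {s : List Bool | s.length = n} {s : List Bool | s.length = n} :=
    fun s (hs : s.length = n) => show (blockSwap a b c s).length = n from (length_blockSwap a b c s).trans hs
  exact ((List.finite_length_eq Bool n).injOn_iff_bijOn_of_mapsTo hm).1 (injOn_blockSwap a b c n)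

/-! ## Block read-outs and the inverse law on long seeds (`a n + b n + c n ≤ n`) -/

section LongSeeds

variable (a b c : ℕ → ℕ) (s : List Bool) (h : a s.length + b s.length + c s.length ≤ s.length)
include h

/-- On a long seed the first block `s ↾ a n` has length `a n`. [folklore] -/
theorem length_blockA : (s.take (a s.length)).length = a s.length :=
  List.length_take_of_le (by omega)

/-- On a long seed the second block `(s ⇂ a n) ↾ b n` has length `b n`. [folklore] -/
theorem length_blockX : ((s.drop (a s.length)).take (b s.length)).length = b s.length :=
  List.length_take_of_le (by rw [List.length_drop]; omega)

/-- On a long seed the third block `(s ⇂ (a n + b n)) ↾ c n` has length `c n`. [folklore] -/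
theorem length_blockY : ((s.drop (a s.length + b s.length)).take (c s.length)).length = c s.length :=
  List.length_take_of_le (by rw [List.length_drop]; omega)

/-- On a long seed the first block of `blockSwap a b c s` is the first block `s ↾ a n` of `s`. [folklore] -/
theorem take_blockSwap : (blockSwap a b c s).take (a s.length) = s.take (a s.length) := by
  unfold blockSwap
  rw [List.take_left' (length_blockA a b c s h)]

/-- On a long seed the second block (length `c n`) of `blockSwap a b c s` is the third block
`(s ⇂ (a n + b n)) ↾ c n` of `s`. [folklore] -/
theorem drop_take_blockSwap_mid :
    ((blockSwap a b c s).drop (a s.length)).take (c s.length) =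
      (s.drop (a s.length + b s.length)).take (c s.length) := by
  unfold blockSwap
  rw [List.drop_left' (length_blockA a b c s h), List.take_left' (length_blockY a b c s h)]

/-- On a long seed the third block (length `b n`) of `blockSwap a b c s` is the second block
`(s ⇂ a n) ↾ b n` of `s`. [folklore] -/
theorem drop_take_blockSwap_last :
    ((blockSwap a b c s).drop (a s.length + c s.length)).take (b s.length) =
      (s.drop (a s.length)).take (b s.length) := by
  unfold blockSwap
  rw [← List.drop_drop (i := c s.length) (j := a s.length), List.drop_left' (length_blockA a b c s h),
    List.drop_left' (length_blockY a b c s h), List.take_left' (length_blockX a b c s h)]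

/-- On a long seed the tail of `blockSwap a b c s` behind its first three blocks is the tail
`s ⇂ (a n + b n + c n)` of `s`. [folklore] -/
theorem drop_blockSwap_add :
    (blockSwap a b c s).drop (a s.length + c s.length + b s.length) =
      s.drop (a s.length + b s.length + c s.length) := by
  unfold blockSwap
  rw [← List.drop_drop (i := b s.length) (j := a s.length + c s.length),
    ← List.drop_drop (i := c s.length) (j := a s.length), List.drop_left' (length_blockA a b c s h),
    List.drop_left' (length_blockY a b c s h), List.drop_left' (length_blockX a b c s h)]

/-- On a long seed the first two blocks of `blockSwap a b c s` together are
`(s ↾ a n) ++ ((s ⇂ (a n + b n)) ↾ c n)`. [folklore] -/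
theorem take_blockSwap_add :
    (blockSwap a b c s).take (a s.length + c s.length) =
      s.take (a s.length) ++ (s.drop (a s.length + b s.length)).take (c s.length) := by
  rw [List.take_add, take_blockSwap a b c s h, drop_take_blockSwap_mid a b c s h]

/-- **Inverse law** on long seeds: swapping the two blocks back recovers the seed,
`blockSwap a c b (blockSwap a b c s) = s` whenever `a n + b n + c n ≤ n = |s|`. [folklore] -/
theorem blockSwap_blockSwap : blockSwap a c b (blockSwap a b c s) = s := by
  rw [blockSwap, length_blockSwap, take_blockSwap a b c s h, drop_take_blockSwap_last a b c s h,
    drop_take_blockSwap_mid a b c s h, drop_blockSwap_add a b c s h]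
  exact take_append_drop₄ s _ _ _

end LongSeeds

end Summit.QuantumAdvantage.QuantumAdvantage.Theorems.WbwObfuscatedGluedTrees.KnowledgeOfWalk
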